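import Mathlib
import Summits.Langlands.Langlands.Theorems.SkinnerWilesDefectOneStrongLiftingAllFiniteEulerZeros

/-!
# Rigidity of the twist-ratio identity — the Gamma-factor-free variant of the single-prime step
# of the L-function line for the ramified clause of `StrongLiftingAllFinite`
# (item stmt-Langlands-15194, route `SkinnerWilesDefectOne`)

Sibling of `…LFactorRigidity` and `…EulerZeros` (same kernel, same line).  The comparison of `Λ(s, P)` with
`∏_{i mod ℓ} Λ(s, π ⊗ ηⁱ)` needs their archimedean factors to agree (archimedean strong lifting, a
named fact).  The line can avoid that input: twist by a finite-order Hecke character `χ` trivial at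
the archimedean places, unramified at the ramified prime `q` with `χ(q) = υ`, ramified at auxiliary
primes outside `S`; the pairs `(π ⊗ χ, P ⊗ (χ ∘ N))` and `(π, P)` have the SAME Gamma factors, so
the RATIO of the two quotient identities is a Gamma-free finite Euler-product identity.  After
prime separation (`…PrimeSeparation`) and clearing the inverses, at `q` it reads — with `α` the
Satake parameter of `π_q` and `(u_j, m_j)` the Euler-factor data of the lift at `w₀ ∣ q` —

  `∏_{a ∈ α}(1 - υaX) ∏_j (1 - υ u_j q^{m_j} X) · ∏_j (1 - u_j X) ∏_{a ∈ α} (1 - qaX)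
     = c · ∏_{a ∈ α}(1 - aX) ∏_j (1 - u_j q^{m_j} X) · ∏_j (1 - υ u_j X) ∏_{a ∈ α}(1 - υqaX)`,

i.e. with `Σ = α + {u_j q^{m_j}}`, `Σ' = q•α + {u_j}`: `υ•Σ + Σ' = Σ + υ•Σ'` as multisets — the
formal difference `Σ - Σ'` is invariant under scaling by `υ`.  THIS FILE proves that this is rigid
as soon as `υ` is not a root of unity of small order (pure algebra over `ℂ`):

* `multiset_eq_of_add_map_mul_eq_of_pow_ne_one` — **scaling lemma**: if `A + υ•B = υ•A + B` for
  multisets of non-zero complex numbers and `υ^N ≠ 1` for `0 < N ≤ card A + card B`, then `A = B`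
  (count along the orbit `z, υz, υ²z, …`, pigeonhole).
* (`blocks_trivial_of_multiset_eq` — the multiset form of `blocks_trivial_of_prod_eq` — lives in
  `…EulerZeros`.)
* `blocks_trivial_of_twist_ratio` — from the displayed identity (any `c`; it is `1`): every
  `m_j = 1` and `α = {u_j}_j`, i.e. `t_{P,w₀} = t_{π,v₀}` — clause (R) at `q`, Gamma-factor-free.

Helper for the item (does not close it); the automorphic inputs (functional equations of all such
twists with a common Gamma factor, existence of `χ` with `χ(q)` of large order — for `F = ℚ` a
Dirichlet character modulo an auxiliary prime `r` with `ord_r(q)` large) are NOT asserted here.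

## References

* R. Godement, H. Jacquet, *Zeta functions of simple algebras*, LNM 260 (1972), Thm. 13.8.
  [GodementJacquet1972]
* J. Arthur, L. Clozel, Ann. of Math. Stud. 120 (1989), Ch. 3, Thm. 5.1. [ArthurClozelAMS120]
-/

set_option linter.dupNamespace false -- project-wide option (lakefile weak.linter.dupNamespace); `Summit.Langlands.Langlands` is the mandated namespace

open Polynomial Finset

namespace Summit.Langlands.Langlands.Theorems.SkinnerWilesDefectOne.StrongLiftingAllFinite

/-! ### The scaling lemma -/

/-- **Scaling lemma.**  Let `υ ∈ ℂˣ` with `υ^N ≠ 1` for `0 < N ≤ card A + card B`, and let `A`, `B`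
be multisets of NON-ZERO complex numbers with `A + υ•B = υ•A + B`.  Then `A = B`.  Proof: the
difference of multiplicities `δ(z) = #_A(z) - #_B(z)` satisfies `δ(υz) = δ(z)`; if `δ(z) ≠ 0` then
the whole orbit `υ^t z` lies in the finite support of `A + B`, so `υ^t z = υ^{t'} z` for some
`t < t' ≤ card A + card B` (pigeonhole), i.e. `υ^{t'-t} = 1`. [folklore] -/
theorem multiset_eq_of_add_map_mul_eq_of_pow_ne_one {υ : ℂ} (hυ : υ ≠ 0) {A B : Multiset ℂ}
    (hA : (0 : ℂ) ∉ A) (hB : (0 : ℂ) ∉ B)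
    (hord : ∀ N : ℕ, 0 < N → N ≤ Multiset.card A + Multiset.card B → υ ^ N ≠ 1)
    (h : A + B.map (υ * ·) = A.map (υ * ·) + B) : A = B := by
  classical
  -- invariance of the difference of multiplicities
  have hcount : ∀ z : ℂ, (Multiset.count (υ * z) A : ℤ) - Multiset.count (υ * z) B =
      (Multiset.count z A : ℤ) - Multiset.count z B := by
    intro z
    have h1 := congrArg (Multiset.count (υ * z)) h
    rw [Multiset.count_add, Multiset.count_add,
      Multiset.count_map_eq_count' _ _ (mul_right_injective₀ hυ),
      Multiset.count_map_eq_count' _ _ (mul_right_injective₀ hυ)] at h1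
    have h2 : (Multiset.count (υ * z) A : ℤ) + Multiset.count z B =
        Multiset.count z A + Multiset.count (υ * z) B := by exact_mod_cast h1
    linarith
  have hiter : ∀ (t : ℕ) (z : ℂ), (Multiset.count (υ ^ t * z) A : ℤ) - Multiset.count (υ ^ t * z) B =
      (Multiset.count z A : ℤ) - Multiset.count z B := by
    intro t
    induction t with
    | zero => intro z; simp
    | succ t ih => intro z; rw [pow_succ, mul_assoc, ih (υ * z), hcount z]
  by_contra hne
  obtain ⟨z, hz⟩ : ∃ z, Multiset.count z A ≠ Multiset.count z B :=
    not_forall.mp fun hall => hne (Multiset.ext.mpr hall)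
  have hz0 : z ≠ 0 := by
    rintro rfl
    rw [Multiset.count_eq_zero.mpr hA, Multiset.count_eq_zero.mpr hB] at hz
    exact hz rfl
  -- the orbit of `z` stays in the support
  set T : Finset ℂ := (A + B).toFinset with hT
  have hmem : ∀ t : ℕ, υ ^ t * z ∈ T := by
    intro t
    have h1 := hiter t z
    rw [hT, Multiset.mem_toFinset, Multiset.mem_add]
    by_contra hnot
    obtain ⟨hnA, hnB⟩ := not_or.mp hnot
    rw [Multiset.count_eq_zero.mpr hnA, Multiset.count_eq_zero.mpr hnB] at h1
    have h2 : (Multiset.count z A : ℤ) = Multiset.count z B := by linarith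
    exact hz (by exact_mod_cast h2)
  have hcardT : T.card ≤ Multiset.card A + Multiset.card B := by
    calc T.card ≤ Multiset.card (A + B) := Multiset.toFinset_card_le _
      _ = Multiset.card A + Multiset.card B := Multiset.card_add _ _
  -- pigeonhole
  obtain ⟨t₁, ht₁, t₂, ht₂, hne12, heq⟩ := Finset.exists_ne_map_eq_of_card_lt_of_maps_to
    (s := Finset.range (T.card + 1)) (t := T) (f := fun t => υ ^ t * z) (by simp)
    (fun t _ => hmem t)
  have key : ∀ t₁ t₂ : ℕ, t₁ ∈ Finset.range (T.card + 1) → t₂ ∈ Finset.range (T.card + 1) →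
      t₁ < t₂ → υ ^ t₁ * z = υ ^ t₂ * z → False := by
    intro t₁ t₂ _ ht₂ hlt heq
    have h1 : υ ^ t₁ * (υ ^ (t₂ - t₁) * z) = υ ^ t₁ * (1 * z) := by
      rw [← mul_assoc, ← pow_add, Nat.add_sub_cancel' hlt.le, one_mul]
      exact heq.symm
    have h2 := mul_left_cancel₀ (pow_ne_zero _ hυ) h1
    have h3 : υ ^ (t₂ - t₁) = 1 := mul_right_cancel₀ hz0 h2
    exact hord (t₂ - t₁) (Nat.sub_pos_of_lt hlt)
      (by have := Finset.mem_range.mp ht₂; omega) h3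
  rcases Nat.lt_or_gt_of_ne hne12 with hlt | hlt
  · exact key t₁ t₂ ht₁ ht₂ hlt heq
  · exact key t₂ t₁ ht₂ ht₁ hlt heq.symm

variable {ι : Type*} [Fintype ι]

/-! ### Rigidity of the twist-ratio identity -/

/-- Products of the factors `1 - sX` over a sum of singletons. [folklore] -/
theorem prod_map_sum_singleton (g : ι → ℂ) (φ : ℂ → ℂ[X]) :
    ((∑ i, ({g i} : Multiset ℂ)).map φ).prod = ∏ i, φ (g i) := by
  have hms : ((∑ i, ({g i} : Multiset ℂ)).map φ) = ∑ i, ({g i} : Multiset ℂ).map φ :=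
    map_sum (Multiset.mapAddMonoidHom φ) _ _
  rw [hms, Multiset.prod_sum]
  simp

/-- Mapping a sum of singletons. [folklore] -/
theorem map_sum_singleton (g : ι → ℂ) (f : ℂ → ℂ) :
    (∑ i, ({g i} : Multiset ℂ)).map f = ∑ i, ({f (g i)} : Multiset ℂ) := by
  have hms : (∑ i, ({g i} : Multiset ℂ)).map f = ∑ i, ({g i} : Multiset ℂ).map f :=
    map_sum (Multiset.mapAddMonoidHom f) _ _
  rw [hms]
  simp

/-- **Rigidity of the twist-ratio identity.**  Let `1 < ‖q‖`, `α` a multiset of non-zero complex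
numbers no two of which have ratio `q`, blocks `(u_i, m_i)` with `u_i ≠ 0`, `m_i ≥ 1`, and
`υ ∈ ℂˣ` with `υ^N ≠ 1` for `0 < N ≤ 2 (card α + card ι)`.  If, in `ℂ[X]`,
`∏_{a ∈ α}(1 - υaX) ∏_i (1 - υ u_i q^{m_i} X) · (∏_i (1 - u_i X) ∏_{a ∈ α}(1 - qaX)) =
c · (∏_{a ∈ α}(1 - aX) ∏_i (1 - u_i q^{m_i} X) · (∏_i (1 - υu_i X) ∏_{a ∈ α}(1 - υqaX)))` for some
`c ∈ ℂ`, then every `m_i = 1` and `α = {u_i}_i`.  Proof: `c = 1` (constant coefficients); reading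
roots, `υ•Σ + Σ' = Σ + υ•Σ'` for `Σ = α + {u_i q^{m_i}}`, `Σ' = q•α + {u_i}`; the scaling lemma
gives `Σ = Σ'`, and `blocks_trivial_of_multiset_eq` concludes. [folklore] -/
theorem blocks_trivial_of_twist_ratio {q υ : ℂ} (hq : 1 < ‖q‖) (hυ : υ ≠ 0) {α : Multiset ℂ}
    (hα : (0 : ℂ) ∉ α) (hgen : ∀ a ∈ α, ∀ b ∈ α, b ≠ q * a) (u : ι → ℂ) (m : ι → ℕ)
    (hu : ∀ i, u i ≠ 0) (hm : ∀ i, 1 ≤ m i)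
    (hord : ∀ N : ℕ, 0 < N → N ≤ 2 * (Multiset.card α + Fintype.card ι) → υ ^ N ≠ 1) (c : ℂ)
    (h : ((α.map fun a => (1 - C (υ * a) * X : ℂ[X])).prod *
          ∏ i, (1 - C (υ * (u i * q ^ m i)) * X)) *
        ((α.map fun a => (1 - C (q * a) * X : ℂ[X])).prod * ∏ i, (1 - C (u i) * X : ℂ[X])) =
      c • (((α.map fun a => (1 - C a * X : ℂ[X])).prod * ∏ i, (1 - C (u i * q ^ m i) * X)) *
        ((α.map fun a => (1 - C (υ * (q * a)) * X : ℂ[X])).prod *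
          ∏ i, (1 - C (υ * u i) * X : ℂ[X])))) :
    (∀ i, m i = 1) ∧ α = ∑ i, ({u i} : Multiset ℂ) := by
  classical
  have hq0 : q ≠ 0 := by
    rintro rfl
    norm_num at hq
  -- the two multisets
  set S : Multiset ℂ := α + ∑ i, ({u i * q ^ m i} : Multiset ℂ) with hS
  set S' : Multiset ℂ := α.map (q * ·) + ∑ i, ({u i} : Multiset ℂ) with hS'
  have hS0 : (0 : ℂ) ∉ S := by
    intro h0
    rcases Multiset.mem_add.mp h0 with h1 | h1
    · exact hα h1
    · obtain ⟨i, -, hi⟩ := Multiset.mem_sum.mp h1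
      rw [Multiset.mem_singleton] at hi
      exact mul_ne_zero (hu i) (pow_ne_zero _ hq0) hi.symm
  have hS'0 : (0 : ℂ) ∉ S' := by
    intro h0
    rcases Multiset.mem_add.mp h0 with h1 | h1
    · obtain ⟨a, ha, hqa⟩ := Multiset.mem_map.mp h1
      exact mul_ne_zero hq0 (fun h' => hα (h' ▸ ha)) hqa
    · obtain ⟨i, -, hi⟩ := Multiset.mem_sum.mp h1
      rw [Multiset.mem_singleton] at hi
      exact hu i hi.symm
  -- the identity as products over `υ•S + S'` and `S + υ•S'`
  set φ : ℂ → ℂ[X] := fun s => (1 - C s * X : ℂ[X]) with hφ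
  have hL : ((S.map (υ * ·) + S').map φ).prod =
      ((α.map fun a => (1 - C (υ * a) * X : ℂ[X])).prod *
          ∏ i, (1 - C (υ * (u i * q ^ m i)) * X)) *
        ((α.map fun a => (1 - C (q * a) * X : ℂ[X])).prod * ∏ i, (1 - C (u i) * X : ℂ[X])) := by
    simp only [hS, hS', hφ, Multiset.map_add, Multiset.prod_add, Multiset.map_map,
      Function.comp_def, map_sum_singleton, prod_map_sum_singleton]
  have hR : ((S + S'.map (υ * ·)).map φ).prod =
      ((α.map fun a => (1 - C a * X : ℂ[X])).prod * ∏ i, (1 - C (u i * q ^ m i) * X)) *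
        ((α.map fun a => (1 - C (υ * (q * a)) * X : ℂ[X])).prod *
          ∏ i, (1 - C (υ * u i) * X : ℂ[X])) := by
    simp only [hS, hS', hφ, Multiset.map_add, Multiset.prod_add, Multiset.map_map,
      Function.comp_def, map_sum_singleton, prod_map_sum_singleton]
  -- `c = 1` by evaluating at `0`
  have hev : ∀ M : Multiset ℂ, Polynomial.eval 0 ((M.map φ).prod) = 1 := by
    intro M
    rw [Polynomial.eval_multiset_prod, Multiset.map_map]
    have : M.map (Polynomial.eval 0 ∘ φ) = M.map fun _ => (1 : ℂ) :=
      Multiset.map_congr rfl fun s _ => by simp [hφ]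
    rw [this, Multiset.map_const', Multiset.prod_replicate, one_pow]
  have hc : c = 1 := by
    have h1 := congrArg (Polynomial.eval 0) h
    rw [← hL, ← hR, Polynomial.eval_smul, hev, hev, smul_eq_mul, mul_one] at h1
    exact h1.symm
  subst hc
  rw [one_smul, ← hL, ← hR] at h
  -- multisets
  have hM : S.map (υ * ·) + S' = S + S'.map (υ * ·) := by
    apply multiset_eq_of_prod_one_sub_C_mul_X_eq
    · intro h0
      rcases Multiset.mem_add.mp h0 with h1 | h1
      · obtain ⟨s, hs, hs0⟩ := Multiset.mem_map.mp h1
        exact mul_ne_zero hυ (fun h' => hS0 (h' ▸ hs)) hs0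
      · exact hS'0 h1
    · intro h0
      rcases Multiset.mem_add.mp h0 with h1 | h1
      · exact hS0 h1
      · obtain ⟨s, hs, hs0⟩ := Multiset.mem_map.mp h1
        exact mul_ne_zero hυ (fun h' => hS'0 (h' ▸ hs)) hs0
    · exact h
  -- the scaling lemma: `S' + υ•S = υ•S' + S` gives `S' = S`
  have hcard : Multiset.card S' + Multiset.card S = 2 * (Multiset.card α + Fintype.card ι) := by
    rw [hS, hS', Multiset.card_add, Multiset.card_add, Multiset.card_map]
    simp [Multiset.card_singleton, Finset.card_univ]
    ring
  have hSS : S' = S := by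
    refine multiset_eq_of_add_map_mul_eq_of_pow_ne_one hυ hS'0 hS0 (fun N hN hNle => hord N hN ?_) ?_
    · rw [← hcard]; exact hNle
    · rw [add_comm, hM, add_comm]
  -- conclude
  refine blocks_trivial_of_multiset_eq hq hα hgen u m hu hm ?_
  rw [← hS, ← hSS, hS']

end Summit.Langlands.Langlands.Theorems.SkinnerWilesDefectOne.StrongLiftingAllFinite
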